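import Literature.MathematicalPhysics.QuantumLattice.XXZGroundStateKomaTasakiSystem
import Literature.MathematicalPhysics.QuantumLattice.XXZAntiferromagnetGroundStateOrderAllDims
import Literature.MathematicalPhysics.QuantumLattice.SpinChainsLiebMattisSpinProofs
import Literature.Probability.LatticeModels.TorusBipartite
import HarnessLib

/-!
# Symmetry breaking in the GROUND STATES of the XXZ / Heisenberg antiferromagnet and of hard-core bosons:
# Koma–Tasaki 1993 Theorem 7.3 (`U(1)`, `≥ √2 σ`) and Corollary 7.2 (`SU(2)`, `≥ √3 σ`) for their own models, by name

T. Koma, H. Tasaki, *Symmetry breaking in Heisenberg antiferromagnets*, Commun. Math. Phys. **158** (1993) 191–214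
(`KomaTasaki1993`, held `paper:doi-10-1007-bf02097237`), §7 "Symmetry breaking in ground states", pp. 209–211:

> Let `Φ_Λ` and `Φ_Λ(B)` be ground states of the Hamiltonians (2.2) and (2.6) [`H_Λ(B) = H_Λ - B O_Λ`],
> respectively. We define the long range order parameter in the ground state `Φ_Λ` as
> `σ = lim_{Λ↑ℤ^d} N⁻¹ √(Φ_Λ, (O_Λ)² Φ_Λ)` (7.1), where we take a subsequence if necessary. …
> **Theorem 7.3.** Assume that the conditions for Theorem 7.1 are valid, and we further have the `U(1)`
> invariance as discussed above [one generator `C`, two components `(O^{(1)}, O^{(2)})`, `CΦ_Λ = 0`]. Also assume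
> that `σ` defined in (7.1) is nonvanishing. Then `liminf_{B↓0} liminf_{Λ↑ℤ^d} N⁻¹(Φ_Λ(B), O^{(1)}_ΛΦ_Λ(B)) ≥ √2 σ`. (7.11)
> **Corollary 7.2.** Assume that the conditions for Theorem 7.1 are valid, and we further have the `SU(2)`
> invariance as in the above i'') [`X^{(i)}_ΛΦ_Λ = 0`, `i = 1,2,3`] and the assumptions iv) and v) in Sect. 2.
> Then `liminf_{B↓0} liminf_{Λ↑ℤ^d} N⁻¹(Φ_Λ(B), O^{(1)}_ΛΦ_Λ(B)) ≥ √3 σ`.                                  (7.3)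

(= T. Koma, H. Tasaki, J. Stat. Phys. **76** (1994) 745–803, Theorem 2.5 (2.30) and the remark after it, "we
replace `√2` with `√3` when the model has an `SU(2)` symmetry"; KT93 p. 193: "the first rigorous result concerning
the existence of such a symmetry breaking in the Heisenberg antiferromagnet was due to Kaplan, Horsch and von der
Linden, who proved the bound `m_s ≥ σ` for the ground state".)

Both are PROVED in the tree for abstract Koma–Tasaki `U(1)` systems (`KomaTasaki.komaTasakiU1Field_u1`,
`KomaTasaki.komaTasakiSU2Field`), and the ground-state long-range order `σ > 0` of the models concerned is PROVED in
the tree (reflection positivity / infrared bounds: Kennedy–Lieb–Shastry 1988, Kubo–Kishi 1988, Björnberg–Ueltschi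
2022 Theorem 3.2 — `xxzAF_ground_planar_of_ne_x`, `hardCoreBoson_ground_planar_of_ne_x`,
`xxzAF_ground_planar_spinHalf_x`, `hardCoreBoson_ground_planar_spinHalf_x`).  This file puts them together for
KT93's own models, via the instance `XXZKT.u1System` / `XXZKT.su2Datum` (`XXZGroundStateKomaTasakiSystem.lean`):

* §1 `re_groundStateFunctional_stagSpin_mul_stagSpin` (KT's `N²σ_Λ² = (Φ_Λ,(O_Λ)²Φ_Λ)` for the tracial ground
  state `ω_GS` = the tree's LRO double sum), `exists_pos_eventually_le_of_hasStaggeredEvenTorusLRO` /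
  `exists_pos_eventually_le_of_hasEvenTorusLRO` (tree LRO ⟹ `∃ a > 0`, eventually `a N² ≤ Re ω_GS((O^{(1)})²)`).
* §2 **`totalSpin_mulVec_eq_zero_of_heisenberg_groundState`** — KT93 i'') for the Heisenberg antiferromagnet on the
  even torus: EVERY ground state is annihilated by `Sˣ_tot, Sʸ_tot, Sᶻ_tot` (Lieb–Mattis: the ground states have total
  spin `S₀ = |(|A|-|B|)|n/2 = 0`, tree `marshall_lieb_mattis_spin_holds`).
* §3 ENGINES along any sequence of tori `Λ_k = (ℤ/L_kℤ)^d`, `N_k → ∞`: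
  **`ground_order_ge_sqrt_two_of_eventually_lro`** (Theorem 7.3): an eventual floor `a N² ≤ Re ω_GS((O^{(1)})²)`,
  `O^{(1)} = Σ_x(-1)^{σx}Sˣ_x`, forces for every `B > 0`, `ε > 0`, eventually, EVERY unit ground state `Φ_B` of
  `H - B·O^{(1)}` to satisfy `N⁻¹ Re Φ_B†O^{(1)}Φ_B ≥ √2·√a - ε` (a long-range-ordered ground eigenstate in an
  `Sᶻ_tot`-sector exists by `Matrix.exists_groundState_eigenvector_re_ge`; then `u1System_isLROEigenstate` and
  `komaTasakiU1Field_u1`); **`ground_order_ge_sqrt_three_of_eventually_lro`** (Corollary 7.2, `Δ = 1`, `J > 0`,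
  even sides): `≥ √3·√a - ε` (`komaTasakiSU2Field` with i'') from §2).
* §4 THE THEOREMS FOR THE MODELS (all `d ≥ 2`; `S = n/2`):
  - `xxzAF_ground_spontaneousStaggeredMagnetisation` — XXZ antiferromagnet `J Σ(SˣSˣ+SʸSʸ+ΔSᶻSᶻ)`, `J > 0`,
    `0 ≤ Δ ≤ 1`, `(d, S) ≠ (2, ½)`: `∃ σ > 0 ∀ B > 0 ∀ ε > 0`, eventually on `(ℤ/(2k+2)ℤ)^d`, every ground state
    `Φ_B` of `H - B·Σ_x(-1)^xSˣ_x` has `N⁻¹Re⟨Φ_B, Σ_x(-1)^xSˣ_x Φ_B⟩ ≥ √2 σ - ε` (Theorem 7.3);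
  - `xxzAF_ground_spontaneousStaggeredMagnetisation_spinHalf_two` — `d = 2`, `S = ½`, `0 ≤ Δ ≤ 0.15` (the tree's
    certified planar window);
  - **`heisenbergAF_ground_spontaneousStaggeredMagnetisation`** — the Heisenberg antiferromagnet `Δ = 1`,
    `(d, S) ≠ (2, ½)`: `≥ √3 σ - ε` (Corollary 7.2 = the ground-state form of KT93 Corollary 1.1 `m_s ≥ √3σ`);
  - `hardCoreBoson_ground_spontaneousOrder` — hard-core bosons / planar ferromagnet `-Σ(SˣSˣ+SʸSʸ+ΔSᶻSᶻ)`,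
    `-1 ≤ Δ ≤ 0`, `(d, S) ≠ (2, ½)`: EVERY ground state of `H - B·Sˣ_tot` has `N⁻¹Re⟨Sˣ_tot⟩ ≥ √2 σ - ε`
    (Theorem 7.3, "electron pair condensation" case); `hardCoreBoson_ground_spontaneousOrder_spinHalf_two` —
    `d = 2`, `S = ½`, `-0.15 ≤ Δ ≤ 0`.
  - tracial / zero-temperature forms (`…_groundStateFunctional`, `…_zeroTemperature`): the same floors for the uniform
    mixture of the sourced ground states (`le_re_groundStateFunctional_div_of_forall_groundState`) and for
    `lim_{β→∞} N⁻¹Re⟨O_Λ⟩_{β,H-B·O_Λ}` (the `β → ∞` limit inside KT93 (1.9)).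
  In each, the volume limit is taken first at fixed `B > 0` (KT93 (7.3)/(7.11): `liminf_{B↓0} liminf_Λ`), and
  `d = 2` IS covered (ground states; contrast the `T > 0` versions `XXZ(Antiferromagnet)ThermalSpontaneousOrder.lean`,
  `d ≥ 3`).  The isotropic `d = 2`, `S = ½` case (square-lattice spin-½ Heisenberg antiferromagnet) is not covered:
  its ground-state Néel order is open.

No definitions, no named facts, no sorry.

## References
* [KomaTasaki1993] T. Koma, H. Tasaki, Commun. Math. Phys. **158** (1993) 191–214, §1 Corollary 1.1 and p. 193,
  §7 (7.1), Theorem 7.1, Corollary 7.2 (7.3), Theorem 7.3 (7.11), pp. 209–213.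
* [KomaTasaki1994] T. Koma, H. Tasaki, J. Stat. Phys. **76** (1994) 745–803, Theorem 2.5 (2.30) and Remark, §3.1.
* [KaplanHorschVonDerLinden1989] T. A. Kaplan, P. Horsch, W. von der Linden, J. Phys. Soc. Jpn. **58** (1989) 3894.
* [LiebMattis1962] E. Lieb, D. Mattis, J. Math. Phys. **3** (1962) 749–751, Theorem 2.
* [KLS1988PRL] T. Kennedy, E. H. Lieb, B. S. Shastry, Phys. Rev. Lett. **61** (1988) 2582–2584.
* [KuboKishi1988] K. Kubo, T. Kishi, Phys. Rev. Lett. **61** (1988) 2585.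
* [BjornbergUeltschi2022] J. E. Björnberg, D. Ueltschi, arXiv:2204.12896, Theorem 3.2.
* [Tasaki2019Tower] H. Tasaki, J. Stat. Phys. **174** (2019) 735–761, Theorems 2.1, 3.4, 3.5, §3.2.
* [Tasaki2020] H. Tasaki, *Physics and Mathematics of Quantum Many-Body Systems*, Springer 2020, §2.4–§2.5, §4.4.
-/

noncomputable section

open Matrix Finset Filter Topology WithLp
open scoped ComplexOrder Matrix.Norms.L2Operator InnerProductSpace ComplexConjugate
open Literature.MathematicalPhysics.QuantumLattice Literature.MathematicalPhysics.QuantumLattice.SpinOperators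
  Literature.MathematicalPhysics.QuantumLattice.KomaTasaki Literature.Probability.LatticeModels

namespace Literature.MathematicalPhysics.QuantumLattice

namespace XXZKT

variable {d : ℕ}

/-! ### §1. Ground-state long-range order in Koma–Tasaki's normalisation -/

section GroundLRO

/-- `|Λ| = L^d`. [cite: KomaTasaki1993, §2 (2.1)] -/
private theorem card_torusSite' (L : ℕ) [NeZero L] : Fintype.card (TorusSite d L) = L ^ d := by
  rw [Fintype.card_pi, prod_const, ZMod.card, card_univ, Fintype.card_fin]

/-- **KT93 (7.1) for the tracial ground state = the tree's LRO double sum**: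
`Re ω_GS((O^{(1)})²) = Σ_{x,y}(-1)^{σx}(-1)^{σy} Re ω_GS(Sˣ_xSˣ_y)`, `O^{(1)} = Σ_x(-1)^{σx}Sˣ_x`,
`ω_GS = groundStateFunctional (xxzHamiltonian n (torusGraph d L) J Δ)`. [cite: KomaTasaki1993, §7 (7.1), §1 (1.7)] -/
theorem re_groundStateFunctional_stagSpin_mul_stagSpin (L : ℕ) [NeZero L] (n : ℕ) (J Δ : ℝ)
    (σ : TorusSite d L → ℕ) :
    ((xxzHamiltonian n (torusGraph d L) J Δ).groundStateFunctional (stagSpin n σ 0 * stagSpin n σ 0)).re =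
      ∑ x : TorusSite d L, ∑ y : TorusSite d L,
        stagSign σ x * stagSign σ y * groundStateXXZCorrTorus 0 (d := d) L n J Δ x y := by
  rw [stagSpin, Finset.sum_mul_sum, map_sum, Complex.re_sum]
  refine Finset.sum_congr rfl fun x _ => ?_
  rw [map_sum, Complex.re_sum]
  refine Finset.sum_congr rfl fun y _ => ?_
  rw [Matrix.smul_mul, Matrix.mul_smul, smul_smul, LinearMap.map_smul, smul_eq_mul, ← Complex.ofReal_mul,
    Complex.re_ofReal_mul, groundStateXXZCorrTorus_of_neZero]

/-- `Re ω_GS((O^{(1)})²) ≥ 0` (positivity of the tracial ground state, `O^{(1)}` Hermitian).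
[cite: KomaTasaki1993, §7 (7.1)] -/
theorem re_groundStateFunctional_stagSpin_mul_stagSpin_nonneg (L : ℕ) [NeZero L] (n : ℕ) (J Δ : ℝ)
    (σ : TorusSite d L → ℕ) :
    0 ≤ ((xxzHamiltonian n (torusGraph d L) J Δ).groundStateFunctional (stagSpin n σ 0 * stagSpin n σ 0)).re :=
  re_groundStateFunctional_mul_self_nonneg _ (isHermitian_stagSpin n σ 0)

/-- **Staggered ground-state LRO (tree `HasStaggeredEvenTorusLRO` of `groundStateXXZCorrTorus 0`) in KT's form**:
there is `a > 0` with `a N² ≤ Re ω_GS((O^{(1)})²)`, `O^{(1)} = Σ_x(-1)^xSˣ_x`, on all large even tori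
`(ℤ/(2k+2)ℤ)^d` (so `σ = √a` is an eventual lower bound for KT93's `σ_Λ` of (7.1)/(7.8)).
[cite: KomaTasaki1993, §7 (7.1), §1 (1.7)] [cite: DLS1978, §1] -/
theorem exists_pos_eventually_le_of_hasStaggeredEvenTorusLRO {n : ℕ} {J Δ : ℝ}
    (h : HasStaggeredEvenTorusLRO (fun L x y => groundStateXXZCorrTorus 0 (d := d) L n J Δ x y)) :
    ∃ a : ℝ, 0 < a ∧ ∀ᶠ k : ℕ in atTop,
      a * (Fintype.card (TorusSite d (2 * k + 2)) : ℝ) ^ 2 ≤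
        ((xxzHamiltonian n (torusGraph d (2 * k + 2)) J Δ).groundStateFunctional
          (stagSpin n (torusParityExp d (2 * k + 2)) 0 * stagSpin n (torusParityExp d (2 * k + 2)) 0)).re := by
  rw [hasStaggeredEvenTorusLRO_iff_holds] at h
  obtain ⟨f, hf, hpos⟩ : ∃ f : ℕ → ℝ, (∀ k, f k =
      (∑ x : TorusSite d (2 * k + 2), ∑ y : TorusSite d (2 * k + 2),
          (-1 : ℝ) ^ (∑ i, (x i).val) * (-1) ^ (∑ i, (y i).val) *
            groundStateXXZCorrTorus 0 (d := d) (2 * k + 2) n J Δ x y) / ((2 * k + 2 : ℕ) : ℝ) ^ (2 * d)) ∧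
      0 < liminf f atTop := ⟨_, fun _ => rfl, h⟩
  have hsum : ∀ k : ℕ, (∑ x : TorusSite d (2 * k + 2), ∑ y : TorusSite d (2 * k + 2),
      (-1 : ℝ) ^ (∑ i, (x i).val) * (-1) ^ (∑ i, (y i).val) *
        groundStateXXZCorrTorus 0 (d := d) (2 * k + 2) n J Δ x y) =
      ((xxzHamiltonian n (torusGraph d (2 * k + 2)) J Δ).groundStateFunctional
        (stagSpin n (torusParityExp d (2 * k + 2)) 0 * stagSpin n (torusParityExp d (2 * k + 2)) 0)).re :=
    fun k => (re_groundStateFunctional_stagSpin_mul_stagSpin (2 * k + 2) n J Δ (torusParityExp d (2 * k + 2))).symm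
  have hcard : ∀ k : ℕ, ((2 * k + 2 : ℕ) : ℝ) ^ (2 * d) = (Fintype.card (TorusSite d (2 * k + 2)) : ℝ) ^ 2 :=
    fun k => by rw [card_torusSite', Nat.cast_pow, ← pow_mul, mul_comm d 2]
  have hnonneg : ∀ k : ℕ, 0 ≤ f k := fun k => by
    rw [hf, hsum]
    exact div_nonneg (re_groundStateFunctional_stagSpin_mul_stagSpin_nonneg _ n J Δ _) (by positivity)
  have hcl : liminf f atTop / 2 < liminf f atTop := half_lt_self hpos
  have hev := eventually_lt_of_lt_liminf hcl (isBoundedUnder_of ⟨0, fun k => hnonneg k⟩)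
  refine ⟨liminf f atTop / 2, half_pos hpos, hev.mono fun k hk => ?_⟩
  have hN : (0 : ℝ) < (Fintype.card (TorusSite d (2 * k + 2)) : ℝ) ^ 2 := by
    have : (0 : ℝ) < Fintype.card (TorusSite d (2 * k + 2)) := Nat.cast_pos.mpr Fintype.card_pos
    positivity
  have hfk : f k * (Fintype.card (TorusSite d (2 * k + 2)) : ℝ) ^ 2 =
      ((xxzHamiltonian n (torusGraph d (2 * k + 2)) J Δ).groundStateFunctional
        (stagSpin n (torusParityExp d (2 * k + 2)) 0 * stagSpin n (torusParityExp d (2 * k + 2)) 0)).re := by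
    rw [hf, hsum, hcard, div_mul_cancel₀ _ hN.ne']
  rw [← hfk]
  exact mul_le_mul_of_nonneg_right hk.le hN.le

/-- **Plain ground-state LRO (tree `HasEvenTorusLRO` of `groundStateXXZCorrTorus 0`) in KT's form** (sign exponent
`σ = 0`, `O^{(1)} = Σ_x(-1)^0Sˣ_x = Sˣ_tot`): there is `a > 0` with `a N² ≤ Re ω_GS((O^{(1)})²)` on all large even tori
`(ℤ/2(j+1)ℤ)^d`. [cite: KomaTasaki1993, §7 (7.1)] [cite: KLS1988PRL, eq. (1) and Theorem] -/
theorem exists_pos_eventually_le_of_hasEvenTorusLRO {n : ℕ} {J Δ : ℝ}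
    (h : HasEvenTorusLRO (fun L x y => groundStateXXZCorrTorus 0 (d := d) L n J Δ x y)) :
    ∃ a : ℝ, 0 < a ∧ ∀ᶠ j : ℕ in atTop,
      a * (Fintype.card (TorusSite d (2 * (j + 1))) : ℝ) ^ 2 ≤
        ((xxzHamiltonian n (torusGraph d (2 * (j + 1))) J Δ).groundStateFunctional
          (stagSpin n (fun _ : TorusSite d (2 * (j + 1)) => 0) 0 *
            stagSpin n (fun _ : TorusSite d (2 * (j + 1)) => 0) 0)).re := by
  rw [hasEvenTorusLRO_iff] at h
  obtain ⟨f, hf, hpos⟩ : ∃ f : ℕ → ℝ, (∀ k, f k =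
      (∑ x ∈ halfOpenBox d (2 * k), ∑ y ∈ halfOpenBox d (2 * k),
        torusPullback (fun L x y => groundStateXXZCorrTorus 0 (d := d) L n J Δ x y) (2 * k) x y) /
          ((halfOpenBox d (2 * k)).card : ℝ) ^ 2) ∧ 0 < liminf f atTop := ⟨_, fun _ => rfl, h⟩
  have hsum : ∀ j : ℕ, (∑ x ∈ halfOpenBox d (2 * (j + 1)), ∑ y ∈ halfOpenBox d (2 * (j + 1)),
      torusPullback (fun L x y => groundStateXXZCorrTorus 0 (d := d) L n J Δ x y) (2 * (j + 1)) x y) =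
      ((xxzHamiltonian n (torusGraph d (2 * (j + 1))) J Δ).groundStateFunctional
        (stagSpin n (fun _ : TorusSite d (2 * (j + 1)) => 0) 0 *
          stagSpin n (fun _ : TorusSite d (2 * (j + 1)) => 0) 0)).re := fun j => by
    simp only [torusPullback_apply]
    rw [sum_sq_halfOpenBox_comp_torusProj, re_groundStateFunctional_stagSpin_mul_stagSpin]
    refine Finset.sum_congr rfl fun x _ => Finset.sum_congr rfl fun y _ => ?_
    rw [stagSign, stagSign, pow_zero, one_mul, one_mul]
  have hcard : ∀ j : ℕ, ((halfOpenBox d (2 * (j + 1))).card : ℝ) ^ 2 =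
      (Fintype.card (TorusSite d (2 * (j + 1))) : ℝ) ^ 2 := fun j => by
    rw [card_halfOpenBox, card_torusSite']
  have hnonneg : ∀ j : ℕ, 0 ≤ f (j + 1) := fun j => by
    rw [hf, hsum]
    exact div_nonneg (re_groundStateFunctional_stagSpin_mul_stagSpin_nonneg _ n J Δ _) (by positivity)
  have hlim : 0 < liminf (fun j : ℕ => f (j + 1)) atTop := by
    rw [Filter.liminf_nat_add f 1]
    exact hpos
  have hcl : liminf (fun j : ℕ => f (j + 1)) atTop / 2 < liminf (fun j : ℕ => f (j + 1)) atTop :=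
    half_lt_self hlim
  have hev := eventually_lt_of_lt_liminf hcl (isBoundedUnder_of ⟨0, fun j => hnonneg j⟩)
  refine ⟨liminf (fun j : ℕ => f (j + 1)) atTop / 2, half_pos hlim, hev.mono fun j hj => ?_⟩
  have hN : (0 : ℝ) < (Fintype.card (TorusSite d (2 * (j + 1))) : ℝ) ^ 2 := by
    have : (0 : ℝ) < Fintype.card (TorusSite d (2 * (j + 1))) := Nat.cast_pos.mpr Fintype.card_pos
    positivity
  have hfj : f (j + 1) * (Fintype.card (TorusSite d (2 * (j + 1))) : ℝ) ^ 2 =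
      ((xxzHamiltonian n (torusGraph d (2 * (j + 1))) J Δ).groundStateFunctional
        (stagSpin n (fun _ : TorusSite d (2 * (j + 1)) => 0) 0 *
          stagSpin n (fun _ : TorusSite d (2 * (j + 1)) => 0) 0)).re := by
    rw [hf, hsum, hcard, div_mul_cancel₀ _ hN.ne']
  rw [← hfj]
  exact mul_le_mul_of_nonneg_right hj.le hN.le

end GroundLRO

/-! ### §2. KT93 i''): every ground state of the Heisenberg antiferromagnet on the even torus is an `SU(2)` singlet -/

section Singlet

/-- `xxzHamiltonian n G J 1 = heisenbergHamiltonian n G J` (each edge term is `𝐒_x·𝐒_y`).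
[cite: Tasaki2020, §2.4 (remarks after eq. (2.4.1))] -/
private theorem xxzHamiltonian_one_eq_heisenberg' {Λ : Type*} [Fintype Λ] [DecidableEq Λ] (n : ℕ)
    (G : SimpleGraph Λ) [DecidableRel G.Adj] (J : ℝ) :
    xxzHamiltonian n G J 1 = heisenbergHamiltonian n G J := by
  rw [xxzHamiltonian, heisenbergHamiltonian]
  congr 1
  refine sum_congr rfl fun e _ => ?_
  induction e using Sym2.ind with
  | h x y =>
    simp only [Sym2.lift_mk, spinDotSym_mk, spinDot, Fin.sum_univ_three, Complex.ofReal_one, one_smul]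

/-- `Re ψ†(𝐒_tot)²ψ = Σ_α ‖S^α_tot ψ‖²`. [cite: Tasaki2020, §2.2 eq. (2.2.13)] -/
theorem re_dotProduct_totalSpinSq_mulVec {Λ : Type*} [Fintype Λ] [DecidableEq Λ] (n : ℕ)
    (ψ : TensorIndex Λ (n + 1) → ℂ) :
    (star ψ ⬝ᵥ (totalSpinSq n *ᵥ ψ)).re =
      ∑ α : Fin 3, ‖(toLp 2 (totalSpin n α *ᵥ ψ) : SpinSpace Λ (n + 1))‖ ^ 2 := by
  rw [totalSpinSq, Matrix.sum_mulVec, dotProduct_sum, Complex.re_sum]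
  refine Finset.sum_congr rfl fun α _ => ?_
  rw [norm_toLp_sq_eq_re_dotProduct, ← Matrix.mulVec_mulVec, Matrix.star_mulVec, ← Matrix.dotProduct_mulVec,
    (totalSpin_isHermitian n α).eq]

/-- **KT93 i'') for the Heisenberg antiferromagnet on the even torus (Lieb–Mattis).**  For `d ≥ 1`, even `L`,
`J > 0` and any spin, EVERY ground state `Φ` of `xxzHamiltonian n (torusGraph d L) J 1 = JΣ𝐒_x·𝐒_y` satisfies
`Sˣ_totΦ = Sʸ_totΦ = Sᶻ_totΦ = 0`: the torus graph is connected and bipartite with equinumerous parity sublattices,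
so by the Lieb–Mattis theorem (tree `marshall_lieb_mattis_spin_holds`) every ground state has total spin
`S₀ = |(|A|-|Aᶜ|)|n/2 = 0`, i.e. `(𝐒_tot)²Φ = 0`, whence each component vanishes (`Σ_α‖S^α_totΦ‖² = 0`).
[cite: LiebMattis1962, Theorem 2] [cite: KomaTasaki1993, §7 i'') (p. 209)] [cite: Tasaki2020, Theorem 2.3] -/
theorem totalSpin_mulVec_eq_zero_of_heisenberg_groundState (hd : 1 ≤ d) (L : ℕ) [NeZero L] (hL : 2 ∣ L) (n : ℕ)
    {J : ℝ} (hJ : 0 < J) {Φ : TensorIndex (TorusSite d L) (n + 1) → ℂ}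
    (hΦ : xxzHamiltonian n (torusGraph d L) J 1 *ᵥ Φ =
      ((xxzHamiltonian n (torusGraph d L) J 1).groundEnergy : ℂ) • Φ)
    (α : Fin 3) : totalSpin n α *ᵥ Φ = 0 := by
  by_cases hΦ0 : Φ = 0
  · rw [hΦ0, Matrix.mulVec_zero]
  have hG := torusGraph_connected_of_proj d L
  have hbip := torusGraph_isBipartiteWith_evenSublattice (d := d) L hL
  have hcard := card_compl_evenSublattice (d := d) L hL ⟨0, hd⟩
  obtain ⟨hspin, -⟩ :=
    marshall_lieb_mattis_spin_holds n (torusGraph d L) (evenSublattice (d := d) L hL) J hG hbip hJ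
  have hS0 : liebMattisSpin n (evenSublattice (d := d) L hL) = 0 := by
    simp [liebMattisSpin, hcard]
  rw [xxzHamiltonian_one_eq_heisenberg'] at hΦ
  have hGS : (heisenbergHamiltonian n (torusGraph d L) J).IsGroundStateVector Φ :=
    (Matrix.isGroundStateVector_iff _ _).2 ⟨hΦ0, (Matrix.mem_groundSpace_iff _ _).2 hΦ⟩
  have hsq : totalSpinSq n *ᵥ Φ = 0 := by
    have h := hspin Φ hGS
    simp only [hS0, zero_mul, Complex.ofReal_zero, zero_smul] at h
    exact h
  have hsum : ∑ β : Fin 3, ‖(toLp 2 (totalSpin n β *ᵥ Φ) : SpinSpace (TorusSite d L) (n + 1))‖ ^ 2 = 0 := by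
    rw [← re_dotProduct_totalSpinSq_mulVec, hsq, dotProduct_zero, Complex.zero_re]
  have hterm := (Finset.sum_eq_zero_iff_of_nonneg (fun β _ => sq_nonneg _)).1 hsum α (Finset.mem_univ α)
  have hnorm : ‖(toLp 2 (totalSpin n α *ᵥ Φ) : SpinSpace (TorusSite d L) (n + 1))‖ = 0 := by
    simpa using hterm
  have h0 : (toLp 2 (totalSpin n α *ᵥ Φ) : SpinSpace (TorusSite d L) (n + 1)) = 0 := norm_eq_zero.mp hnorm
  simpa using h0

end Singlet

/-! ### §3. The engines: ground-state long-range order ⟹ order under the symmetry-breaking field -/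

section Engine

/-- **Every ground state ⟹ the tracial ground state.**  If every normalised ground state `Φ` of a Hermitian `K`
has `c ≤ N⁻¹ Re Φ†OΦ` (`N ≥ 0`), then so does their uniform mixture `ω_{GS,K} = groundStateFunctional K`:
`c ≤ N⁻¹ Re ω_{GS,K}(O)` (a ground state minimising `Re Φ†OΦ` over an orthonormal basis of the ground space exists,
`Matrix.exists_groundState_eigenvector_re_ge` applied to `-O`).  KT93's `Φ_Λ(B)` is ANY ground state; the tracial
ground state is the `β → ∞` limit of the Gibbs state used in (1.9). [cite: KomaTasaki1993, §7 (before (7.1)), §1 (1.9)]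
[cite: Tasaki2020, §2.1, App. A.2] -/
theorem le_re_groundStateFunctional_div_of_forall_groundState {m : Type*} [Fintype m] [DecidableEq m] [Nonempty m]
    {K : Matrix m m ℂ} (hK : K.IsHermitian) (O : Matrix m m ℂ) {c N : ℝ} (hN : 0 ≤ N)
    (h : ∀ Φ : m → ℂ, star Φ ⬝ᵥ Φ = 1 → K *ᵥ Φ = (K.groundEnergy : ℂ) • Φ → c ≤ (star Φ ⬝ᵥ (O *ᵥ Φ)).re / N) :
    c ≤ (K.groundStateFunctional O).re / N := by
  obtain ⟨Φ, hΦ, hKΦ, -, hO⟩ := Matrix.exists_groundState_eigenvector_re_ge hK hK rfl (-O)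
  rw [map_neg, Complex.neg_re, neg_mulVec, dotProduct_neg, Complex.neg_re, neg_le_neg_iff] at hO
  exact (h Φ hΦ hKΦ).trans (div_le_div_of_nonneg_right hO hN)

/-- **KT93 THEOREM 7.3 FOR QUANTUM SPINS (engine, `U(1)`, factor `√2`).**  Along any sequence of tori
`Λ_k = (ℤ/L_kℤ)^d` with `N_k = |Λ_k| → ∞`, sign exponents `σ_k`, and the XXZ Hamiltonian
`H_k = xxzHamiltonian n (torusGraph d L_k) J Δ` (any `J, Δ`): if the tracial ground states have the eventual
long-range-order floor `a N_k² ≤ Re ω_GS((O^{(1)}_k)²)`, `O^{(1)}_k = Σ_x(-1)^{σ_k x}Sˣ_x`, `a > 0`, then for every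
field `B > 0` and every `ε > 0`, eventually in `k`, EVERY unit ground state `Φ_B` of `H_k - B·O^{(1)}_k` satisfies
`N_k⁻¹ Re Φ_B†O^{(1)}_kΦ_B ≥ √2·√a - ε` — i.e. `liminf_k N_k⁻¹(Φ_k(B), O^{(1)}Φ_k(B)) ≥ √2 σ`, `σ = √a`, for every
`B > 0` (volume limit first), a fortiori (7.11).  Proof as printed, by name: a long-range-ordered ground eigenstate in
an `Sᶻ_tot`-sector (`Matrix.exists_groundState_eigenvector_re_ge`), hypothesis iv) (`u1System_isLROEigenstate`),
then `KomaTasaki.komaTasakiU1Field_u1` (the symmetry-breaking trial state (7.23) and the variational transfer (7.5)).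
[cite: KomaTasaki1993, Theorem 7.3 (7.11), (7.5), (7.23)–(7.24)] [cite: KomaTasaki1994, Theorem 2.5 (2.30)] -/
theorem ground_order_ge_sqrt_two_of_eventually_lro {n : ℕ} {J Δ a : ℝ} (Lk : ℕ → ℕ) [∀ k, NeZero (Lk k)]
    (σ : ∀ k, TorusSite d (Lk k) → ℕ) (ha : 0 < a)
    (hN : Tendsto (fun k => Fintype.card (TorusSite d (Lk k))) atTop atTop)
    (hlro : ∀ᶠ k : ℕ in atTop, a * (Fintype.card (TorusSite d (Lk k)) : ℝ) ^ 2 ≤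
      ((xxzHamiltonian n (torusGraph d (Lk k)) J Δ).groundStateFunctional
        (stagSpin n (σ k) 0 * stagSpin n (σ k) 0)).re)
    {B ε : ℝ} (hB : 0 < B) (hε : 0 < ε) :
    ∀ᶠ k : ℕ in atTop, ∀ ΦB : TensorIndex (TorusSite d (Lk k)) (n + 1) → ℂ, star ΦB ⬝ᵥ ΦB = 1 →
      (xxzHamiltonian n (torusGraph d (Lk k)) J Δ - (B : ℂ) • stagSpin n (σ k) 0) *ᵥ ΦB =
        ((xxzHamiltonian n (torusGraph d (Lk k)) J Δ - (B : ℂ) • stagSpin n (σ k) 0).groundEnergy : ℂ) • ΦB →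
      Real.sqrt 2 * Real.sqrt a - ε ≤
        (star ΦB ⬝ᵥ (stagSpin n (σ k) 0 *ᵥ ΦB)).re / (Fintype.card (TorusSite d (Lk k)) : ℝ) := by
  set μ : ℝ := Real.sqrt a / sNorm n with hμ_def
  have hs : 0 < sNorm n := lt_of_lt_of_le zero_lt_one (one_le_sNorm n)
  have hμ : 0 < μ := div_pos (Real.sqrt_pos.2 ha) hs
  have hμs : Real.sqrt 2 * μ * sNorm n = Real.sqrt 2 * Real.sqrt a := by
    rw [hμ_def, mul_assoc, div_mul_cancel₀ _ hs.ne']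
  obtain ⟨N₀, hN₀⟩ := KomaTasaki.komaTasakiU1Field_u1.{0, 0} μ (sNorm n) (hbar d n J Δ) (2 * d + 2) hB hε
  filter_upwards [hlro, Filter.tendsto_atTop.mp hN N₀] with k hk hNk ΦB hΦB hHB
  -- the long-range-ordered ground eigenstate in an `Sᶻ_tot`-sector, and hypothesis iv)
  set H₀ := xxzHamiltonian n (torusGraph d (Lk k)) J Δ with hH₀
  have hH₀herm : H₀.IsHermitian := xxzHamiltonian_isHermitian n _ J Δ
  obtain ⟨Φ, hΦ, hHΦ, ⟨ν, hNΦ⟩, hlroΦ⟩ := Matrix.exists_groundState_eigenvector_re_ge hH₀herm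
    (totalSpin_isHermitian n 2) (HardCoreBoson.commute_xxzHamiltonian_totalSpin_two n _ J Δ).eq
    (stagSpin n (σ k) 0 * stagSpin n (σ k) 0)
  have hlro' : (μ * sNorm n * (Fintype.card (TorusSite d (Lk k)) : ℝ)) ^ 2 ≤
      (star Φ ⬝ᵥ (stagSpin n (σ k) 0 *ᵥ (stagSpin n (σ k) 0 *ᵥ Φ))).re := by
    rw [hμ_def, div_mul_cancel₀ _ hs.ne', mul_pow, Real.sq_sqrt ha.le, Matrix.mulVec_mulVec]
    exact hk.trans hlroΦ
  set sys := u1System d (Lk k) n J Δ (σ k) with hsys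
  have hLRO : KomaTasaki.IsLROEigenstate sys (toLp 2 Φ) H₀.groundEnergy μ :=
    u1System_isLROEigenstate d (Lk k) n J Δ (σ k) hΦ hHΦ hNΦ hμ hlro'
  -- the ground-state hypotheses
  have hground : ∀ ψ : SpinSpace (TorusSite d (Lk k)) (n + 1), ‖ψ‖ = 1 →
      H₀.groundEnergy ≤ (⟪ψ, sys.hamiltonian ψ⟫_ℂ).re := by
    intro ψ hψ
    rw [hsys, u1System_hamiltonian]
    exact Matrix.groundEnergy_le_re_inner_toEuclideanCLM' hH₀herm ψ hψ
  set HB := H₀ - (B : ℂ) • stagSpin n (σ k) 0 with hHB_def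
  have hHBherm : HB.IsHermitian :=
    hH₀herm.sub ((isHermitian_stagSpin n (σ k) 0).smul (by rw [isSelfAdjoint_iff, Complex.star_def, Complex.conj_ofReal]))
  have hfield : sys.hamiltonian - (B : ℂ) • sys.order 0 =
      toEuclideanCLM (n := TensorIndex (TorusSite d (Lk k)) (n + 1)) (𝕜 := ℂ) HB := by
    rw [hsys, u1System_field]
  have hmin : ∀ ψ : SpinSpace (TorusSite d (Lk k)) (n + 1), ‖ψ‖ = 1 →
      (⟪(toLp 2 ΦB : SpinSpace (TorusSite d (Lk k)) (n + 1)),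
          (sys.hamiltonian - (B : ℂ) • sys.order 0) (toLp 2 ΦB)⟫_ℂ).re ≤
        (⟪ψ, (sys.hamiltonian - (B : ℂ) • sys.order 0) ψ⟫_ℂ).re := by
    intro ψ hψ
    rw [hfield]
    exact Matrix.re_inner_toEuclideanCLM_le_of_groundState hHBherm hΦB hHB ψ hψ
  -- KT93 Theorem 7.3
  have h := hN₀ sys (toLp 2 Φ) H₀.groundEnergy hLRO rfl le_rfl le_rfl hground hNk (toLp 2 ΦB)
    (norm_toLp_eq_one_of_dotProduct hΦB) hmin
  rw [hμs, hsys, u1System_order_zero, toEuclideanCLM_toLp, inner_toLp_toLp_eq_dotProduct] at h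
  exact h

/-- **KT93 COROLLARY 7.2 FOR QUANTUM SPINS (engine, `SU(2)`, factor `√3`).**  The same along EVEN tori for the
ISOTROPIC antiferromagnet `H_k = xxzHamiltonian n (torusGraph d L_k) J 1 = JΣ𝐒_x·𝐒_y`, `J > 0`, `d ≥ 1`: an eventual
floor `a N_k² ≤ Re ω_GS((O^{(1)}_k)²)` forces, for every `B > 0`, `ε > 0`, eventually, EVERY unit ground state `Φ_B` of
`H_k - B·O^{(1)}_k` to satisfy `N_k⁻¹ Re Φ_B†O^{(1)}_kΦ_B ≥ √3·√a - ε` (7.3).  The extra hypothesis i'') (`SU(2)`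
invariance of the symmetric ground state) holds by `totalSpin_mulVec_eq_zero_of_heisenberg_groundState` (Lieb–Mattis);
then `KomaTasaki.komaTasakiSU2Field` over the datum `su2Datum` (Theorem 7.3 combined with Theorem 6.1).
[cite: KomaTasaki1993, Corollary 7.2 (7.3), proof p. 211; Theorem 6.1] [cite: KomaTasaki1994, Theorem 2.5 and Remark] -/
theorem ground_order_ge_sqrt_three_of_eventually_lro (hd : 1 ≤ d) {n : ℕ} {J a : ℝ} (hJ : 0 < J)
    (Lk : ℕ → ℕ) [∀ k, NeZero (Lk k)] (heven : ∀ k, 2 ∣ Lk k)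
    (σ : ∀ k, TorusSite d (Lk k) → ℕ) (ha : 0 < a)
    (hN : Tendsto (fun k => Fintype.card (TorusSite d (Lk k))) atTop atTop)
    (hlro : ∀ᶠ k : ℕ in atTop, a * (Fintype.card (TorusSite d (Lk k)) : ℝ) ^ 2 ≤
      ((xxzHamiltonian n (torusGraph d (Lk k)) J 1).groundStateFunctional
        (stagSpin n (σ k) 0 * stagSpin n (σ k) 0)).re)
    {B ε : ℝ} (hB : 0 < B) (hε : 0 < ε) :
    ∀ᶠ k : ℕ in atTop, ∀ ΦB : TensorIndex (TorusSite d (Lk k)) (n + 1) → ℂ, star ΦB ⬝ᵥ ΦB = 1 →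
      (xxzHamiltonian n (torusGraph d (Lk k)) J 1 - (B : ℂ) • stagSpin n (σ k) 0) *ᵥ ΦB =
        ((xxzHamiltonian n (torusGraph d (Lk k)) J 1 - (B : ℂ) • stagSpin n (σ k) 0).groundEnergy : ℂ) • ΦB →
      Real.sqrt 3 * Real.sqrt a - ε ≤
        (star ΦB ⬝ᵥ (stagSpin n (σ k) 0 *ᵥ ΦB)).re / (Fintype.card (TorusSite d (Lk k)) : ℝ) := by
  set μ : ℝ := Real.sqrt a / sNorm n with hμ_def
  have hs : 0 < sNorm n := lt_of_lt_of_le zero_lt_one (one_le_sNorm n)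
  have hμ : 0 < μ := div_pos (Real.sqrt_pos.2 ha) hs
  have hμs : Real.sqrt 3 * μ * sNorm n = Real.sqrt 3 * Real.sqrt a := by
    rw [hμ_def, mul_assoc, div_mul_cancel₀ _ hs.ne']
  obtain ⟨N₀, hN₀⟩ := KomaTasaki.komaTasakiSU2Field.{0, 0} μ (sNorm n) (hbar d n J 1) (2 * d + 2) hB hε
  filter_upwards [hlro, Filter.tendsto_atTop.mp hN N₀] with k hk hNk ΦB hΦB hHB
  set H₀ := xxzHamiltonian n (torusGraph d (Lk k)) J 1 with hH₀
  have hH₀herm : H₀.IsHermitian := xxzHamiltonian_isHermitian n _ J 1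
  obtain ⟨Φ, hΦ, hHΦ, ⟨ν, hNΦ⟩, hlroΦ⟩ := Matrix.exists_groundState_eigenvector_re_ge hH₀herm
    (totalSpin_isHermitian n 2) (HardCoreBoson.commute_xxzHamiltonian_totalSpin_two n _ J 1).eq
    (stagSpin n (σ k) 0 * stagSpin n (σ k) 0)
  have hlro' : (μ * sNorm n * (Fintype.card (TorusSite d (Lk k)) : ℝ)) ^ 2 ≤
      (star Φ ⬝ᵥ (stagSpin n (σ k) 0 *ᵥ (stagSpin n (σ k) 0 *ᵥ Φ))).re := by
    rw [hμ_def, div_mul_cancel₀ _ hs.ne', mul_pow, Real.sq_sqrt ha.le, Matrix.mulVec_mulVec]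
    exact hk.trans hlroΦ
  set sys := u1System d (Lk k) n J 1 (σ k) with hsys
  have hLRO : KomaTasaki.IsLROEigenstate sys (toLp 2 Φ) H₀.groundEnergy μ :=
    u1System_isLROEigenstate d (Lk k) n J 1 (σ k) hΦ hHΦ hNΦ hμ hlro'
  -- i''): the symmetric ground state is an `SU(2)` singlet (Lieb–Mattis)
  have hJΦ : ∀ a', (su2Datum d (Lk k) n J 1 (σ k)).J a' (toLp 2 Φ) = 0 :=
    su2Datum_J_apply_eq_zero d (Lk k) n J 1 (σ k)
      (totalSpin_mulVec_eq_zero_of_heisenberg_groundState hd (Lk k) (heven k) n hJ hHΦ 0)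
      (totalSpin_mulVec_eq_zero_of_heisenberg_groundState hd (Lk k) (heven k) n hJ hHΦ 1)
  have hground : ∀ ψ : SpinSpace (TorusSite d (Lk k)) (n + 1), ‖ψ‖ = 1 →
      H₀.groundEnergy ≤ (⟪ψ, sys.hamiltonian ψ⟫_ℂ).re := by
    intro ψ hψ
    rw [hsys, u1System_hamiltonian]
    exact Matrix.groundEnergy_le_re_inner_toEuclideanCLM' hH₀herm ψ hψ
  set HB := H₀ - (B : ℂ) • stagSpin n (σ k) 0 with hHB_def
  have hHBherm : HB.IsHermitian :=
    hH₀herm.sub ((isHermitian_stagSpin n (σ k) 0).smul (by rw [isSelfAdjoint_iff, Complex.star_def, Complex.conj_ofReal]))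
  have hfield : sys.hamiltonian - (B : ℂ) • sys.order 0 =
      toEuclideanCLM (n := TensorIndex (TorusSite d (Lk k)) (n + 1)) (𝕜 := ℂ) HB := by
    rw [hsys, u1System_field]
  have hmin : ∀ ψ : SpinSpace (TorusSite d (Lk k)) (n + 1), ‖ψ‖ = 1 →
      (⟪(toLp 2 ΦB : SpinSpace (TorusSite d (Lk k)) (n + 1)),
          (sys.hamiltonian - (B : ℂ) • sys.order 0) (toLp 2 ΦB)⟫_ℂ).re ≤
        (⟪ψ, (sys.hamiltonian - (B : ℂ) • sys.order 0) ψ⟫_ℂ).re := by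
    intro ψ hψ
    rw [hfield]
    exact Matrix.re_inner_toEuclideanCLM_le_of_groundState hHBherm hΦB hHB ψ hψ
  -- KT93 Corollary 7.2
  have h := hN₀ sys (su2Datum d (Lk k) n J 1 (σ k)) (toLp 2 Φ) H₀.groundEnergy hLRO hJΦ rfl le_rfl le_rfl
    hground hNk (toLp 2 ΦB) (norm_toLp_eq_one_of_dotProduct hΦB) hmin
  rw [hμs, hsys, u1System_order_zero, toEuclideanCLM_toLp, inner_toLp_toLp_eq_dotProduct] at h
  exact h

end Engine

/-! ### §4. The theorems for Koma–Tasaki's own models -/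

section Models

/-- **XXZ ANTIFERROMAGNET, `0 ≤ Δ ≤ 1`, GROUND STATES: spontaneous staggered magnetisation `≥ √2 σ` under an
infinitesimal staggered field (KT93 Theorem 7.3 for its own model).**  For every `d ≥ 2`, spin `S = n/2 ≥ ½` with
`(d, S) ≠ (2, ½)`, `J > 0` and `0 ≤ Δ ≤ 1` there is `σ > 0` — a long-range order of the symmetric ground states,
`σ² N² ≤ (Φ_Λ,(O_Λ)²Φ_Λ)` eventually, from the tree's proved planar order `xxzAF_ground_planar_of_ne_x`
(Kubo–Kishi / Björnberg–Ueltschi) — such that for every staggered field `B > 0` and every `ε > 0`, eventually on the even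
tori `Λ = (ℤ/(2k+2)ℤ)^d`, EVERY normalised ground state `Φ_B` of `H - B·O_Λ`,
`H = xxzHamiltonian n (torusGraph d (2k+2)) J Δ = JΣ_{⟨x,y⟩}(SˣSˣ+SʸSʸ+ΔSᶻSᶻ)`, `O_Λ = Σ_x(-1)^xSˣ_x`, satisfies
**`N⁻¹ Re⟨Φ_B, O_ΛΦ_B⟩ ≥ √2 σ - ε`**; i.e. `liminf_Λ N⁻¹(Φ_Λ(B), O_ΛΦ_Λ(B)) ≥ √2σ` for every `B > 0`, hence (7.11).
Covers `d = 2` for `S ≥ 1`. [cite: KomaTasaki1993, Theorem 7.3 (7.11), §1 (1.1)–(1.2)] [cite: KomaTasaki1994, Theorem 2.5, §3.1]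
[cite: BjornbergUeltschi2022, Theorem 3.2] [cite: KuboKishi1988] -/
theorem xxzAF_ground_spontaneousStaggeredMagnetisation (hd : 2 ≤ d) {n : ℕ} (hn : 1 ≤ n) (hdn : ¬ (d = 2 ∧ n = 1))
    {J : ℝ} (hJ : 0 < J) {Δ : ℝ} (hΔ : 0 ≤ Δ) (hΔ' : Δ ≤ 1) :
    ∃ σ : ℝ, 0 < σ ∧ ∀ B : ℝ, 0 < B → ∀ ε : ℝ, 0 < ε → ∀ᶠ k : ℕ in atTop,
      ∀ ΦB : TensorIndex (TorusSite d (2 * k + 2)) (n + 1) → ℂ, star ΦB ⬝ᵥ ΦB = 1 →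
        (xxzHamiltonian n (torusGraph d (2 * k + 2)) J Δ -
            (B : ℂ) • stagSpin n (torusParityExp d (2 * k + 2)) 0) *ᵥ ΦB =
          ((xxzHamiltonian n (torusGraph d (2 * k + 2)) J Δ -
              (B : ℂ) • stagSpin n (torusParityExp d (2 * k + 2)) 0).groundEnergy : ℂ) • ΦB →
        Real.sqrt 2 * σ - ε ≤
          (star ΦB ⬝ᵥ (stagSpin n (torusParityExp d (2 * k + 2)) 0 *ᵥ ΦB)).re /
            (Fintype.card (TorusSite d (2 * k + 2)) : ℝ) := by
  obtain ⟨a, ha, hlro⟩ :=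
    exists_pos_eventually_le_of_hasStaggeredEvenTorusLRO (xxzAF_ground_planar_of_ne_x hd hn hdn hJ hΔ hΔ')
  exact ⟨Real.sqrt a, Real.sqrt_pos.2 ha, fun B hB ε hε =>
    ground_order_ge_sqrt_two_of_eventually_lro (fun k => 2 * k + 2) (fun k => torusParityExp d (2 * k + 2)) ha
      (tendsto_card_torusSite_two_mul_add_two (by omega)) hlro hB hε⟩

/-- **The spin-½ XXZ antiferromagnet on `ℤ²`, `0 ≤ Δ ≤ 0.15` (the tree's certified planar window
`xxzAF_ground_planar_spinHalf_x`): spontaneous staggered magnetisation `≥ √2 σ` under an infinitesimal staggered field in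
the ground states**, same form as `xxzAF_ground_spontaneousStaggeredMagnetisation` with `d = 2`, `n = 1`.
[cite: KomaTasaki1993, Theorem 7.3 (7.11)] [cite: WischmannMullerhartmann1991, Abstract (p. 647)] [cite: KuboKishi1988] -/
theorem xxzAF_ground_spontaneousStaggeredMagnetisation_spinHalf_two {J : ℝ} (hJ : 0 < J) {Δ : ℝ} (hΔ : 0 ≤ Δ)
    (hΔ' : Δ ≤ 0.15) :
    ∃ σ : ℝ, 0 < σ ∧ ∀ B : ℝ, 0 < B → ∀ ε : ℝ, 0 < ε → ∀ᶠ k : ℕ in atTop,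
      ∀ ΦB : TensorIndex (TorusSite 2 (2 * k + 2)) (1 + 1) → ℂ, star ΦB ⬝ᵥ ΦB = 1 →
        (xxzHamiltonian 1 (torusGraph 2 (2 * k + 2)) J Δ -
            (B : ℂ) • stagSpin 1 (torusParityExp 2 (2 * k + 2)) 0) *ᵥ ΦB =
          ((xxzHamiltonian 1 (torusGraph 2 (2 * k + 2)) J Δ -
              (B : ℂ) • stagSpin 1 (torusParityExp 2 (2 * k + 2)) 0).groundEnergy : ℂ) • ΦB →
        Real.sqrt 2 * σ - ε ≤
          (star ΦB ⬝ᵥ (stagSpin 1 (torusParityExp 2 (2 * k + 2)) 0 *ᵥ ΦB)).re /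
            (Fintype.card (TorusSite 2 (2 * k + 2)) : ℝ) := by
  obtain ⟨a, ha, hlro⟩ :=
    exists_pos_eventually_le_of_hasStaggeredEvenTorusLRO (xxzAF_ground_planar_spinHalf_x J hJ Δ hΔ hΔ')
  exact ⟨Real.sqrt a, Real.sqrt_pos.2 ha, fun B hB ε hε =>
    ground_order_ge_sqrt_two_of_eventually_lro (fun k => 2 * k + 2) (fun k => torusParityExp 2 (2 * k + 2)) ha
      (tendsto_card_torusSite_two_mul_add_two one_le_two) hlro hB hε⟩

/-- **HEISENBERG ANTIFERROMAGNET, GROUND STATES: spontaneous staggered magnetisation `≥ √3 σ` under an infinitesimal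
staggered field — KT93 COROLLARY 7.2 FOR ITS OWN MODEL (the ground-state form of Corollary 1.1 `m_s ≥ √3σ`).**  For every
`d ≥ 2`, spin `S = n/2 ≥ ½` with `(d, S) ≠ (2, ½)` and `J > 0` there is `σ > 0` (Néel long-range order of the symmetric
ground states, from `xxzAF_ground_planar_of_ne_x` at `Δ = 1`: Kennedy–Lieb–Shastry / Kubo–Kishi / Björnberg–Ueltschi)
such that for every staggered field `B > 0` and every `ε > 0`, eventually on the even tori `Λ = (ℤ/(2k+2)ℤ)^d`, EVERY
normalised ground state `Φ_B` of `H - B·O_Λ`, `H = xxzHamiltonian n (torusGraph d (2k+2)) J 1 = JΣ_{⟨x,y⟩}𝐒_x·𝐒_y`,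
`O_Λ = Σ_x(-1)^xSˣ_x`, satisfies **`N⁻¹ Re⟨Φ_B, O_ΛΦ_B⟩ ≥ √3 σ - ε`** (the `SU(2)` invariance i'') of the symmetric ground
state is the Lieb–Mattis singlet, `totalSpin_mulVec_eq_zero_of_heisenberg_groundState`).  Covers `d = 2`, `S ≥ 1`; the
square-lattice spin-½ case is not covered (its ground-state Néel order is open).
[cite: KomaTasaki1993, Corollary 7.2 (7.3), Corollary 1.1 (1.10), §7 i'')] [cite: KomaTasaki1994, Theorem 2.5 and Remark]
[cite: LiebMattis1962, Theorem 2] [cite: KLS1988PRL, Theorem] [cite: BjornbergUeltschi2022, Theorem 3.2] -/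
theorem heisenbergAF_ground_spontaneousStaggeredMagnetisation (hd : 2 ≤ d) {n : ℕ} (hn : 1 ≤ n)
    (hdn : ¬ (d = 2 ∧ n = 1)) {J : ℝ} (hJ : 0 < J) :
    ∃ σ : ℝ, 0 < σ ∧ ∀ B : ℝ, 0 < B → ∀ ε : ℝ, 0 < ε → ∀ᶠ k : ℕ in atTop,
      ∀ ΦB : TensorIndex (TorusSite d (2 * k + 2)) (n + 1) → ℂ, star ΦB ⬝ᵥ ΦB = 1 →
        (xxzHamiltonian n (torusGraph d (2 * k + 2)) J 1 -
            (B : ℂ) • stagSpin n (torusParityExp d (2 * k + 2)) 0) *ᵥ ΦB =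
          ((xxzHamiltonian n (torusGraph d (2 * k + 2)) J 1 -
              (B : ℂ) • stagSpin n (torusParityExp d (2 * k + 2)) 0).groundEnergy : ℂ) • ΦB →
        Real.sqrt 3 * σ - ε ≤
          (star ΦB ⬝ᵥ (stagSpin n (torusParityExp d (2 * k + 2)) 0 *ᵥ ΦB)).re /
            (Fintype.card (TorusSite d (2 * k + 2)) : ℝ) := by
  obtain ⟨a, ha, hlro⟩ :=
    exists_pos_eventually_le_of_hasStaggeredEvenTorusLRO (xxzAF_ground_planar_of_ne_x hd hn hdn hJ zero_le_one le_rfl)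
  exact ⟨Real.sqrt a, Real.sqrt_pos.2 ha, fun B hB ε hε =>
    ground_order_ge_sqrt_three_of_eventually_lro (by omega) hJ (fun k => 2 * k + 2) (fun k => ⟨k + 1, by ring⟩)
      (fun k => torusParityExp d (2 * k + 2)) ha (tendsto_card_torusSite_two_mul_add_two (by omega)) hlro hB hε⟩

/-- **HARD-CORE BOSONS / PLANAR FERROMAGNET, GROUND STATES: spontaneous `U(1)` breaking `≥ √2 σ` under an infinitesimal
field (KT93 Theorem 7.3, the "electron pair condensation"-type `U(1)` case).**  For every `d ≥ 2`, `S = n/2 ≥ ½` with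
`(d, S) ≠ (2, ½)` and `-1 ≤ Δ ≤ 0` there is `σ > 0` (off-diagonal long-range order of the symmetric ground states, tree
`hardCoreBoson_ground_planar_of_ne_x`; `Δ = 0` is Kennedy–Lieb–Shastry's XY model) such that for every field `B > 0`
and `ε > 0`, eventually on the even tori `Λ = (ℤ/2(j+1)ℤ)^d`, EVERY normalised ground state `Φ_B` of `H - B·Sˣ_tot`,
`H = xxzHamiltonian n (torusGraph d (2(j+1))) (-1) Δ = -Σ_{⟨x,y⟩}(SˣSˣ+SʸSʸ+ΔSᶻSᶻ)` (lattice bosons with nearest-neighbour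
repulsion `|Δ|`), satisfies **`N⁻¹ Re⟨Φ_B, Sˣ_totΦ_B⟩ ≥ √2 σ - ε`**.  Covers `d = 2` for `S ≥ 1`.
[cite: KomaTasaki1993, Theorem 7.3 (7.11), p. 211] [cite: KLS1988PRL, eq. (1) and Theorem] [cite: BjornbergUeltschi2022, Theorem 3.2] -/
theorem hardCoreBoson_ground_spontaneousOrder (hd : 2 ≤ d) {n : ℕ} (hn : 1 ≤ n) (hdn : ¬ (d = 2 ∧ n = 1))
    {Δ : ℝ} (hΔ : -1 ≤ Δ) (hΔ' : Δ ≤ 0) :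
    ∃ σ : ℝ, 0 < σ ∧ ∀ B : ℝ, 0 < B → ∀ ε : ℝ, 0 < ε → ∀ᶠ j : ℕ in atTop,
      ∀ ΦB : TensorIndex (TorusSite d (2 * (j + 1))) (n + 1) → ℂ, star ΦB ⬝ᵥ ΦB = 1 →
        (xxzHamiltonian n (torusGraph d (2 * (j + 1))) (-1) Δ - (B : ℂ) • totalSpin n 0) *ᵥ ΦB =
          ((xxzHamiltonian n (torusGraph d (2 * (j + 1))) (-1) Δ - (B : ℂ) • totalSpin n 0).groundEnergy : ℂ) • ΦB →
        Real.sqrt 2 * σ - ε ≤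
          (star ΦB ⬝ᵥ (totalSpin n 0 *ᵥ ΦB)).re / (Fintype.card (TorusSite d (2 * (j + 1))) : ℝ) := by
  obtain ⟨a, ha, hlro⟩ :=
    exists_pos_eventually_le_of_hasEvenTorusLRO (hardCoreBoson_ground_planar_of_ne_x hd hn hdn hΔ hΔ')
  refine ⟨Real.sqrt a, Real.sqrt_pos.2 ha, fun B hB ε hε => ?_⟩
  have h := ground_order_ge_sqrt_two_of_eventually_lro (J := -1) (Δ := Δ) (fun j => 2 * (j + 1))
    (fun j => fun _ : TorusSite d (2 * (j + 1)) => 0) ha (tendsto_card_torusSite_two_mul_succ (by omega)) hlro hB hε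
  simp only [stagSpin_zero_eq_totalSpin] at h
  exact h

/-- **Spin-½ hard-core bosons on `ℤ²` with weak nearest-neighbour repulsion, `-0.15 ≤ Δ ≤ 0` (the tree's certified
window `hardCoreBoson_ground_planar_spinHalf_x`): spontaneous `U(1)` breaking `≥ √2 σ` in the ground states under an
infinitesimal field**, same form as `hardCoreBoson_ground_spontaneousOrder` with `d = 2`, `n = 1`.
[cite: KomaTasaki1993, Theorem 7.3 (7.11)] [cite: KLS1988PRL, eq. (1) and Theorem] [cite: KuboKishi1988] -/
theorem hardCoreBoson_ground_spontaneousOrder_spinHalf_two {Δ : ℝ} (hΔ : -0.15 ≤ Δ) (hΔ' : Δ ≤ 0) :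
    ∃ σ : ℝ, 0 < σ ∧ ∀ B : ℝ, 0 < B → ∀ ε : ℝ, 0 < ε → ∀ᶠ j : ℕ in atTop,
      ∀ ΦB : TensorIndex (TorusSite 2 (2 * (j + 1))) (1 + 1) → ℂ, star ΦB ⬝ᵥ ΦB = 1 →
        (xxzHamiltonian 1 (torusGraph 2 (2 * (j + 1))) (-1) Δ - (B : ℂ) • totalSpin 1 0) *ᵥ ΦB =
          ((xxzHamiltonian 1 (torusGraph 2 (2 * (j + 1))) (-1) Δ - (B : ℂ) • totalSpin 1 0).groundEnergy : ℂ) • ΦB →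
        Real.sqrt 2 * σ - ε ≤
          (star ΦB ⬝ᵥ (totalSpin 1 0 *ᵥ ΦB)).re / (Fintype.card (TorusSite 2 (2 * (j + 1))) : ℝ) := by
  obtain ⟨a, ha, hlro⟩ :=
    exists_pos_eventually_le_of_hasEvenTorusLRO (hardCoreBoson_ground_planar_spinHalf_x Δ hΔ hΔ')
  refine ⟨Real.sqrt a, Real.sqrt_pos.2 ha, fun B hB ε hε => ?_⟩
  have h := ground_order_ge_sqrt_two_of_eventually_lro (J := -1) (Δ := Δ) (fun j => 2 * (j + 1))
    (fun j => fun _ : TorusSite 2 (2 * (j + 1)) => 0) ha (tendsto_card_torusSite_two_mul_succ one_le_two) hlro hB hε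
  simp only [stagSpin_zero_eq_totalSpin] at h
  exact h

/-- **Heisenberg antiferromagnet, tracial form**: under the hypotheses of
`heisenbergAF_ground_spontaneousStaggeredMagnetisation`, for every `B > 0`, `ε > 0`, eventually on the even tori the
uniform mixture `ω_{GS,B}` of the ground states of `H - B·O_Λ` has `N⁻¹ Re ω_{GS,B}(O_Λ) ≥ √3 σ - ε`.
[cite: KomaTasaki1993, Corollary 7.2 (7.3), §1 (1.9)] [cite: Tasaki2020, §2.1] -/
theorem heisenbergAF_ground_spontaneousStaggeredMagnetisation_groundStateFunctional (hd : 2 ≤ d) {n : ℕ} (hn : 1 ≤ n)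
    (hdn : ¬ (d = 2 ∧ n = 1)) {J : ℝ} (hJ : 0 < J) :
    ∃ σ : ℝ, 0 < σ ∧ ∀ B : ℝ, 0 < B → ∀ ε : ℝ, 0 < ε → ∀ᶠ k : ℕ in atTop,
      Real.sqrt 3 * σ - ε ≤
        ((xxzHamiltonian n (torusGraph d (2 * k + 2)) J 1 -
              (B : ℂ) • stagSpin n (torusParityExp d (2 * k + 2)) 0).groundStateFunctional
            (stagSpin n (torusParityExp d (2 * k + 2)) 0)).re /
          (Fintype.card (TorusSite d (2 * k + 2)) : ℝ) := by
  obtain ⟨σ, hσ, h⟩ := heisenbergAF_ground_spontaneousStaggeredMagnetisation hd hn hdn hJ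
  refine ⟨σ, hσ, fun B hB ε hε => (h B hB ε hε).mono fun k hk => ?_⟩
  have hHB : (xxzHamiltonian n (torusGraph d (2 * k + 2)) J 1 -
      (B : ℂ) • stagSpin n (torusParityExp d (2 * k + 2)) 0).IsHermitian :=
    (xxzHamiltonian_isHermitian n _ J 1).sub ((isHermitian_stagSpin n _ 0).smul
      (by rw [isSelfAdjoint_iff, Complex.star_def, Complex.conj_ofReal]))
  exact le_re_groundStateFunctional_div_of_forall_groundState hHB _ (Nat.cast_nonneg _) hk

/-- **Heisenberg antiferromagnet, zero-temperature-limit form** (the `β → ∞` limit inside KT93 (1.9) taken before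
`Λ ↑ ℤ^d`): for every `B > 0`, `ε > 0`, eventually on the even tori, `lim_{β→∞} N⁻¹ Re⟨O_Λ⟩_{β, H - B·O_Λ}` exists and
is `≥ √3 σ - ε`. [cite: KomaTasaki1993, §1 (1.9), §7 (p. 209), Corollary 7.2] [cite: Tasaki2020, App. A.2] -/
theorem heisenbergAF_ground_spontaneousStaggeredMagnetisation_zeroTemperature (hd : 2 ≤ d) {n : ℕ} (hn : 1 ≤ n)
    (hdn : ¬ (d = 2 ∧ n = 1)) {J : ℝ} (hJ : 0 < J) :
    ∃ σ : ℝ, 0 < σ ∧ ∀ B : ℝ, 0 < B → ∀ ε : ℝ, 0 < ε → ∀ᶠ k : ℕ in atTop, ∃ m : ℝ,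
      Tendsto (fun β : ℝ => (gibbsState β
          (xxzHamiltonian n (torusGraph d (2 * k + 2)) J 1 - (B : ℂ) • stagSpin n (torusParityExp d (2 * k + 2)) 0)
          (stagSpin n (torusParityExp d (2 * k + 2)) 0)).re / (Fintype.card (TorusSite d (2 * k + 2)) : ℝ))
        atTop (𝓝 m) ∧
      Real.sqrt 3 * σ - ε ≤ m := by
  obtain ⟨σ, hσ, h⟩ := heisenbergAF_ground_spontaneousStaggeredMagnetisation_groundStateFunctional hd hn hdn hJ
  refine ⟨σ, hσ, fun B hB ε hε => (h B hB ε hε).mono fun k hk => ⟨_, ?_, hk⟩⟩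
  have hHB : (xxzHamiltonian n (torusGraph d (2 * k + 2)) J 1 -
      (B : ℂ) • stagSpin n (torusParityExp d (2 * k + 2)) 0).IsHermitian :=
    (xxzHamiltonian_isHermitian n _ J 1).sub ((isHermitian_stagSpin n _ 0).smul
      (by rw [isSelfAdjoint_iff, Complex.star_def, Complex.conj_ofReal]))
  exact ((Complex.continuous_re.tendsto _).comp (Matrix.tendsto_gibbsState_atTop_holds hHB _)).div_const _

/-- **XXZ antiferromagnet `0 ≤ Δ ≤ 1`, tracial form**: eventually on the even tori the uniform mixture `ω_{GS,B}` of the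
ground states of `H - B·O_Λ` has `N⁻¹ Re ω_{GS,B}(O_Λ) ≥ √2 σ - ε`. [cite: KomaTasaki1993, Theorem 7.3 (7.11), §1 (1.9)] -/
theorem xxzAF_ground_spontaneousStaggeredMagnetisation_groundStateFunctional (hd : 2 ≤ d) {n : ℕ} (hn : 1 ≤ n)
    (hdn : ¬ (d = 2 ∧ n = 1)) {J : ℝ} (hJ : 0 < J) {Δ : ℝ} (hΔ : 0 ≤ Δ) (hΔ' : Δ ≤ 1) :
    ∃ σ : ℝ, 0 < σ ∧ ∀ B : ℝ, 0 < B → ∀ ε : ℝ, 0 < ε → ∀ᶠ k : ℕ in atTop,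
      Real.sqrt 2 * σ - ε ≤
        ((xxzHamiltonian n (torusGraph d (2 * k + 2)) J Δ -
              (B : ℂ) • stagSpin n (torusParityExp d (2 * k + 2)) 0).groundStateFunctional
            (stagSpin n (torusParityExp d (2 * k + 2)) 0)).re /
          (Fintype.card (TorusSite d (2 * k + 2)) : ℝ) := by
  obtain ⟨σ, hσ, h⟩ := xxzAF_ground_spontaneousStaggeredMagnetisation hd hn hdn hJ hΔ hΔ'
  refine ⟨σ, hσ, fun B hB ε hε => (h B hB ε hε).mono fun k hk => ?_⟩
  have hHB : (xxzHamiltonian n (torusGraph d (2 * k + 2)) J Δ -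
      (B : ℂ) • stagSpin n (torusParityExp d (2 * k + 2)) 0).IsHermitian :=
    (xxzHamiltonian_isHermitian n _ J Δ).sub ((isHermitian_stagSpin n _ 0).smul
      (by rw [isSelfAdjoint_iff, Complex.star_def, Complex.conj_ofReal]))
  exact le_re_groundStateFunctional_div_of_forall_groundState hHB _ (Nat.cast_nonneg _) hk

/-- **Hard-core bosons, tracial form**: eventually on the even tori the uniform mixture `ω_{GS,B}` of the ground states
of `H - B·Sˣ_tot` has `N⁻¹ Re ω_{GS,B}(Sˣ_tot) ≥ √2 σ - ε`. [cite: KomaTasaki1993, Theorem 7.3 (7.11), p. 211] -/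
theorem hardCoreBoson_ground_spontaneousOrder_groundStateFunctional (hd : 2 ≤ d) {n : ℕ} (hn : 1 ≤ n)
    (hdn : ¬ (d = 2 ∧ n = 1)) {Δ : ℝ} (hΔ : -1 ≤ Δ) (hΔ' : Δ ≤ 0) :
    ∃ σ : ℝ, 0 < σ ∧ ∀ B : ℝ, 0 < B → ∀ ε : ℝ, 0 < ε → ∀ᶠ j : ℕ in atTop,
      Real.sqrt 2 * σ - ε ≤
        ((xxzHamiltonian n (torusGraph d (2 * (j + 1))) (-1) Δ - (B : ℂ) • totalSpin n 0).groundStateFunctional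
            (totalSpin n 0)).re / (Fintype.card (TorusSite d (2 * (j + 1))) : ℝ) := by
  obtain ⟨σ, hσ, h⟩ := hardCoreBoson_ground_spontaneousOrder hd hn hdn hΔ hΔ'
  refine ⟨σ, hσ, fun B hB ε hε => (h B hB ε hε).mono fun j hj => ?_⟩
  have hHB : (xxzHamiltonian n (torusGraph d (2 * (j + 1))) (-1) Δ - (B : ℂ) • totalSpin n 0).IsHermitian :=
    (xxzHamiltonian_isHermitian n _ (-1) Δ).sub ((totalSpin_isHermitian n 0).smul
      (by rw [isSelfAdjoint_iff, Complex.star_def, Complex.conj_ofReal]))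
  exact le_re_groundStateFunctional_div_of_forall_groundState hHB _ (Nat.cast_nonneg _) hj

end Models

end XXZKT

end Literature.MathematicalPhysics.QuantumLattice
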